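import Literature.RingTheory.LocalCohomology.HypersurfaceConnectedness
import Literature.RingTheory.LocalCohomology.GrothendieckConnectedness
import Literature.AlgebraicGeometry.Resolution.FormalFibres
import HarnessLib

/-!
# Grothendieck's connectedness theorem (SGA 2 XIII 2.1) — proof

Topic `Literature/RingTheory/LocalCohomology`. Discharge of the named fact
`GrothendieckConnectedness` (`GrothendieckConnectedness.lean`): for a complete Noetherian local ring
`A` whose irreducible components have dimension `≥ k + 2` and are pairwise linked through subschemes
of dimension `≥ k + 1`, and `f₁, …, f_m ∈ 𝔪` with `m ≤ k`, the components of `B = A/(f₁, …, f_m)`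
have dimension `≥ k − m + 2` and are pairwise linked through subschemes of dimension `≥ k − m + 1`.

The proof is Grothendieck's induction on `m` (SGA 2 XIII, proof of 2.1), run on the invariant

  `Inv(R, N)`: every irreducible component of `Spec R` has dimension `≥ N + 1`, and for every closed
  `Z ⊆ Spec R` of dimension `< N` the open set `Spec R ∖ Z` is connected,

which for `R = A`, `N = k + 1` follows from the hypotheses (`conn_of_pairwise`: the components
`V(P) ∖ Z` are connected and pairwise linked outside `Z`), descends from `R` to `R/aR` with `N ↦ N − 1`
(`grothendieck_step`, `inv_quotient_span`), and for `R = B`, `N = k − m + 1` gives back the pairwise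
form (`pairwise_of_conn`: remove the union of the small pairwise intersections). The descent step is
where the geometry happens: `V(a) ∖ Z` is the union over the components `V(P)` of `Spec R` of the
sets `V(P) ∩ V(a) ∖ Z`, each of which is connected by **Grothendieck's connectedness theorem for a
hypersurface in the complete local domain `R/P`** (`isPreconnected_zeroLocus_diff`,
`HypersurfaceConnectedness.lean`, the SGA 2 XIII 2.1 engine proved in `ConnectednessCore.lean`), and
two groups of these sets always meet outside `Z` because two suitable components meet in dimension
`≥ N` and cutting by `a` loses at most one dimension (Krull's principal ideal theorem and the
dimension formula in the catenary complete local domains `R/𝔭`,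
`le_ringKrullDim_quotient_of_mem_minimalPrimes_sup_span`). Part (a) is the same dimension count.

Everything is proved; no definitions, no named facts.

## References

* [Grothendieck1968SGA2] A. Grothendieck, SGA 2, Exp. XIII §2, Thm. 2.1 and its proof
  (arXiv:math/0511279, pp. 95–96).
* [BrodmannSharp1998] M. Brodmann, R. Sharp, *Local cohomology*, CUP 1998, Ch. 19 (19.2.8–19.2.11).
* [Matsumura1987] H. Matsumura, *Commutative Ring Theory*, Thm. 29.4, Thm. 31.6, §5.
-/

noncomputable section

open IsLocalRing PrimeSpectrum Literature.AlgebraicGeometry.Resolution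

universe u

namespace Literature.RingTheory.LocalCohomology

/-! ## Point-set topology: unions of connected pieces -/

section Topology

variable {X : Type*} [TopologicalSpace X]

/-- A union of preconnected pieces is preconnected as soon as every `2`-colouring of the index set
with both colours used has two pieces of different colours which meet (then the intersection graph
of the pieces is connected). [folklore] -/
theorem isPreconnected_iUnion_of_crossing {ι : Type*} {C : ι → Set X}
    (hC : ∀ i, IsPreconnected (C i))
    (hcross : ∀ T : Set ι, T.Nonempty → Tᶜ.Nonempty → ∃ i ∈ T, ∃ j ∈ Tᶜ, (C i ∩ C j).Nonempty) :
    IsPreconnected (⋃ i, C i) := by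
  refine IsPreconnected.iUnion_of_reflTransGen hC fun i j => ?_
  by_contra hij
  obtain ⟨a, ha, b, hb, hab⟩ :=
    hcross {k | Relation.ReflTransGen (fun i j => (C i ∩ C j).Nonempty) i k}
      ⟨i, Relation.ReflTransGen.refl⟩ ⟨j, hij⟩
  exact hb (Relation.ReflTransGen.tail ha hab)

end Topology

/-! ## Spectra: zero loci, dimensions of closed subsets, transport along surjections -/

section Spectrum

variable {R : Type u} [CommRing R]

/-- `x ∈ V(I) ↔ I ⊆ x`. [folklore] -/
theorem mem_zeroLocus_ideal_iff {I : Ideal R} {p : PrimeSpectrum R} :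
    p ∈ zeroLocus (I : Set R) ↔ I ≤ p.asIdeal := by
  rw [mem_zeroLocus, SetLike.coe_subset_coe]

/-- If `n ≤ dim R/I` then some prime `𝔭 ⊇ I` has `n ≤ dim R/𝔭` (the bottom of a chain of primes of
length `n` above `I`). [folklore] -/
theorem exists_prime_le_ringKrullDim_quotient {I : Ideal R} {n : ℕ}
    (h : (n : WithBot ℕ∞) ≤ ringKrullDim (R ⧸ I)) :
    ∃ 𝔭 : Ideal R, 𝔭.IsPrime ∧ I ≤ 𝔭 ∧ (n : WithBot ℕ∞) ≤ ringKrullDim (R ⧸ 𝔭) := by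
  rw [ringKrullDim_quotient] at h
  obtain ⟨l, hl⟩ := Order.le_krullDim_iff.mp h
  refine ⟨l.head.1.asIdeal, l.head.1.2, mem_zeroLocus_ideal_iff.mp l.head.2, ?_⟩
  let l' : LTSeries (zeroLocus (R := R) ((l.head.1.asIdeal : Ideal R) : Set R)) :=
    ⟨l.length, fun i => ⟨(l i).1, fun y hy => l.head_le i hy⟩, fun i => l.step i⟩
  have h' : ((l'.length : ℕ) : WithBot ℕ∞) ≤ ringKrullDim (R ⧸ l.head.1.asIdeal) := by
    rw [ringKrullDim_quotient]
    exact Order.LTSeries.length_le_krullDim l'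
  rw [← hl]
  exact h'

/-- For a prime `P`, the set `V(P) ∖ V(𝔠)` is preconnected: it is empty or contains the generic point
`P` of `V(P)`. [folklore] -/
theorem isPreconnected_zeroLocus_prime_diff (P 𝔠 : Ideal R) [hP : P.IsPrime] :
    IsPreconnected (zeroLocus (P : Set R) \ zeroLocus (𝔠 : Set R)) := by
  by_cases h : 𝔠 ≤ P
  · have : zeroLocus (P : Set R) \ zeroLocus (𝔠 : Set R) = ∅ :=
      Set.sdiff_eq_empty.mpr (zeroLocus_anti_mono_ideal h)
    rw [this]
    exact isPreconnected_empty
  · refine isPreconnected_of_forall_specializes' (x₀ := ⟨P, hP⟩)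
      ⟨mem_zeroLocus_ideal_iff.mpr le_rfl, fun h' => h (mem_zeroLocus_ideal_iff.mp h')⟩
      fun x hx => ?_
    rw [← le_iff_specializes, ← asIdeal_le_asIdeal]
    exact mem_zeroLocus_ideal_iff.mp hx.1

/-- `dim R/φ⁻¹(J) = dim R'/J` for a surjection `φ : R → R'`. [folklore] -/
theorem ringKrullDim_quotient_comap_eq_of_surjective {R' : Type u} [CommRing R'] (φ : R →+* R')
    (hφ : Function.Surjective φ) (J : Ideal R') :
    ringKrullDim (R ⧸ J.comap φ) = ringKrullDim (R' ⧸ J) := by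
  have hker : RingHom.ker ((Ideal.Quotient.mk J).comp φ) = J.comap φ := by
    rw [← RingHom.comap_ker, Ideal.mk_ker]
  exact ringKrullDim_eq_of_ringEquiv ((Ideal.quotEquivOfEq hker.symm).trans
    (RingHom.quotientKerEquivOfSurjective (f := (Ideal.Quotient.mk J).comp φ)
      (Ideal.Quotient.mk_surjective.comp hφ)))

/-- Transport of the dimension bound for irreducible components along a surjection `φ : R → R'`:
the components of `Spec R' = V(ker φ)` are the minimal primes of `ker φ`. [folklore] -/
theorem sdim_of_surjective {R' : Type u} [CommRing R'] (φ : R →+* R')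
    (hφ : Function.Surjective φ) {m : ℕ}
    (h : ∀ Q ∈ (RingHom.ker φ).minimalPrimes, (m : WithBot ℕ∞) ≤ ringKrullDim (R ⧸ Q)) :
    ∀ Q' ∈ minimalPrimes R', (m : WithBot ℕ∞) ≤ ringKrullDim (R' ⧸ Q') := by
  intro Q' hQ'
  have hQ : Q'.comap φ ∈ (RingHom.ker φ).minimalPrimes := by
    rw [RingHom.ker_eq_comap_bot]
    exact Ideal.minimalPrimes_comap_of_surjective hφ hQ'
  rw [← ringKrullDim_quotient_comap_eq_of_surjective φ hφ Q']
  exact h _ hQ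

/-- Transport of the connectedness property "`Spec ∖ Z` is connected whenever all components of `Z`
have dimension `< m`" along a surjection `φ : R → R'`, from its relative form on the closed subset
`V(ker φ) ≅ Spec R'` of `Spec R`. [folklore] -/
theorem conn_of_surjective {R' : Type u} [CommRing R'] (φ : R →+* R')
    (hφ : Function.Surjective φ) {m : ℕ}
    (h : ∀ 𝔠 : Ideal R,
      (∀ 𝔮 : Ideal R, 𝔮.IsPrime → 𝔠 ≤ 𝔮 → ringKrullDim (R ⧸ 𝔮) < (m : WithBot ℕ∞)) →
        IsPreconnected (zeroLocus ((RingHom.ker φ : Ideal R) : Set R) \ zeroLocus (𝔠 : Set R))) :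
    ∀ 𝔠' : Ideal R',
      (∀ 𝔮' : Ideal R', 𝔮'.IsPrime → 𝔠' ≤ 𝔮' → ringKrullDim (R' ⧸ 𝔮') < (m : WithBot ℕ∞)) →
        IsPreconnected (zeroLocus (𝔠' : Set R'))ᶜ := by
  intro 𝔠' h𝔠'
  have hdim : ∀ 𝔮 : Ideal R, 𝔮.IsPrime → 𝔠'.comap φ ≤ 𝔮 →
      ringKrullDim (R ⧸ 𝔮) < (m : WithBot ℕ∞) := by
    intro 𝔮 h𝔮 hle
    have hker : RingHom.ker φ ≤ 𝔮 := (Ideal.comap_mono bot_le).trans hle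
    have h1 : (𝔮.map φ).IsPrime := Ideal.map_isPrime_of_surjective hφ hker
    have h2 : 𝔠' ≤ 𝔮.map φ := by
      rw [← Ideal.map_comap_of_surjective φ hφ 𝔠']
      exact Ideal.map_mono hle
    have h3 : (𝔮.map φ).comap φ = 𝔮 := by
      rw [Ideal.comap_map_of_surjective φ hφ, ← RingHom.ker_eq_comap_bot, sup_eq_left.mpr hker]
    have := h𝔠' _ h1 h2
    rwa [← ringKrullDim_quotient_comap_eq_of_surjective φ hφ, h3] at this
  have hpre := h _ hdim
  have hemb := isClosedEmbedding_comap_of_surjective R' φ hφ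
  refine hemb.isInducing.isPreconnected_image.mp ?_
  rwa [Set.image_compl_eq_range_sdiff_image hemb.injective, range_comap_of_surjective R' φ hφ,
    image_comap_zeroLocus_eq_zeroLocus_comap R' φ hφ]

/-- Transport of both halves of the induction invariant along a ring isomorphism. [folklore] -/
theorem inv_of_ringEquiv {R' : Type u} [CommRing R'] (ψ : R ≃+* R') {N : ℕ}
    (hsd : ∀ P ∈ minimalPrimes R, ((N + 1 : ℕ) : WithBot ℕ∞) ≤ ringKrullDim (R ⧸ P))
    (hconn : ∀ 𝔠 : Ideal R,
      (∀ 𝔮 : Ideal R, 𝔮.IsPrime → 𝔠 ≤ 𝔮 → ringKrullDim (R ⧸ 𝔮) < (N : WithBot ℕ∞)) →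
        IsPreconnected (zeroLocus (𝔠 : Set R))ᶜ) :
    (∀ P ∈ minimalPrimes R', ((N + 1 : ℕ) : WithBot ℕ∞) ≤ ringKrullDim (R' ⧸ P)) ∧
    ∀ 𝔠 : Ideal R',
      (∀ 𝔮 : Ideal R', 𝔮.IsPrime → 𝔠 ≤ 𝔮 → ringKrullDim (R' ⧸ 𝔮) < (N : WithBot ℕ∞)) →
        IsPreconnected (zeroLocus (𝔠 : Set R'))ᶜ := by
  have hsurj : Function.Surjective ψ.toRingHom := ψ.surjective
  have hker : RingHom.ker ψ.toRingHom = ⊥ :=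
    (RingHom.injective_iff_ker_eq_bot _).mp ψ.injective
  refine ⟨sdim_of_surjective ψ.toRingHom hsurj fun Q hQ => hsd Q (by rw [hker] at hQ; exact hQ),
    conn_of_surjective ψ.toRingHom hsurj fun 𝔠 h𝔠 => ?_⟩
  rw [hker, zeroLocus_bot, ← Set.compl_eq_univ_sdiff]
  exact hconn 𝔠 h𝔠

/-- **From connectedness in dimension `j` to pairwise linking.** If every irreducible component of
`Spec R` has dimension `≥ j` and `Spec R ∖ Z` is connected for every closed `Z` all of whose
components have dimension `< j`, then for every `2`-colouring of the components using both colours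
two components of different colours meet along a closed subset of dimension `≥ j` (remove the union
`Z` of all the small intersections `V(C₁ + C₂)`; the two colour classes would disconnect
`Spec R ∖ Z`). [cite: Grothendieck1968SGA2, Exp. XIII, proof of Thm. 2.1] -/
theorem pairwise_of_conn [IsNoetherianRing R] (j : ℕ)
    (hconn : ∀ 𝔠 : Ideal R,
      (∀ 𝔮 : Ideal R, 𝔮.IsPrime → 𝔠 ≤ 𝔮 → ringKrullDim (R ⧸ 𝔮) < (j : WithBot ℕ∞)) →
        IsPreconnected (zeroLocus (𝔠 : Set R))ᶜ)
    (hdim : ∀ Q ∈ minimalPrimes R, (j : WithBot ℕ∞) ≤ ringKrullDim (R ⧸ Q)) :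
    ∀ S : Set (PrimeSpectrum R), (∃ C ∈ S, C.asIdeal ∈ minimalPrimes R) →
      (∃ C ∉ S, C.asIdeal ∈ minimalPrimes R) →
        ∃ C₁ ∈ S, ∃ C₂ ∉ S, C₁.asIdeal ∈ minimalPrimes R ∧ C₂.asIdeal ∈ minimalPrimes R ∧
          (j : WithBot ℕ∞) ≤ ringKrullDim (R ⧸ (C₁.asIdeal ⊔ C₂.asIdeal)) := by
  rintro S ⟨A₁, hA₁S, hA₁⟩ ⟨A₂, hA₂S, hA₂⟩
  by_contra hcon
  have hlt : ∀ C₁ ∈ S, ∀ C₂ ∉ S, C₁.asIdeal ∈ minimalPrimes R → C₂.asIdeal ∈ minimalPrimes R →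
      ringKrullDim (R ⧸ (C₁.asIdeal ⊔ C₂.asIdeal)) < (j : WithBot ℕ∞) := by
    intro C₁ h₁ C₂ h₂ h₁' h₂'
    by_contra h
    exact hcon ⟨C₁, h₁, C₂, h₂, h₁', h₂', not_lt.mp h⟩
  -- the finitely many minimal primes, split according to `S`
  have hfin : (PrimeSpectrum.asIdeal ⁻¹' minimalPrimes R : Set (PrimeSpectrum R)).Finite :=
    (Ideal.finite_minimalPrimes_of_isNoetherianRing R (⊥ : Ideal R)).preimage
      (Set.injOn_of_injective fun x y h => PrimeSpectrum.ext h)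
  have hT₁f : {p : PrimeSpectrum R | p.asIdeal ∈ minimalPrimes R ∧ p ∈ S}.Finite :=
    hfin.subset fun p hp => hp.1
  have hT₂f : {p : PrimeSpectrum R | p.asIdeal ∈ minimalPrimes R ∧ p ∉ S}.Finite :=
    hfin.subset fun p hp => hp.1
  -- the bad locus `Z`: the union of the small intersections `V(C₁ + C₂)`
  obtain ⟨Z, hZ⟩ : ∃ Z : Set (PrimeSpectrum R),
      Z = ⋃ p ∈ {p : PrimeSpectrum R | p.asIdeal ∈ minimalPrimes R ∧ p ∈ S},
        ⋃ q ∈ {p : PrimeSpectrum R | p.asIdeal ∈ minimalPrimes R ∧ p ∉ S},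
          zeroLocus ((p.asIdeal ⊔ q.asIdeal : Ideal R) : Set R) := ⟨_, rfl⟩
  have hZc : IsClosed Z := hZ ▸ hT₁f.isClosed_biUnion fun p _ =>
    hT₂f.isClosed_biUnion fun q _ => isClosed_zeroLocus _
  have hmemZ : ∀ x : PrimeSpectrum R, x ∈ Z ↔
      ∃ p : PrimeSpectrum R, (p.asIdeal ∈ minimalPrimes R ∧ p ∈ S) ∧
        ∃ q : PrimeSpectrum R, (q.asIdeal ∈ minimalPrimes R ∧ q ∉ S) ∧
          p.asIdeal ⊔ q.asIdeal ≤ x.asIdeal := by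
    intro x
    simp only [hZ, Set.mem_iUnion, Set.mem_setOf_eq, mem_zeroLocus_ideal_iff, exists_prop]
  have hZ𝔠 : zeroLocus ((vanishingIdeal Z : Ideal R) : Set R) = Z := by
    rw [zeroLocus_vanishingIdeal_eq_closure, hZc.closure_eq]
  have h𝔠dim : ∀ 𝔮 : Ideal R, 𝔮.IsPrime → vanishingIdeal Z ≤ 𝔮 →
      ringKrullDim (R ⧸ 𝔮) < (j : WithBot ℕ∞) := by
    intro 𝔮 h𝔮 hle
    have hmem : (⟨𝔮, h𝔮⟩ : PrimeSpectrum R) ∈ Z := by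
      rw [← hZ𝔠]
      exact mem_zeroLocus_ideal_iff.mpr hle
    obtain ⟨p, hp, q, hq, hpq⟩ := (hmemZ _).mp hmem
    exact lt_of_le_of_lt (ringKrullDim_le_of_surjective (Ideal.Quotient.factor hpq)
      (Ideal.Quotient.factor_surjective hpq)) (hlt p hp.2 q hq.2 hp.1 hq.1)
  have hpre := hconn (vanishingIdeal Z) h𝔠dim
  rw [isPreconnected_iff_subset_of_disjoint_closed, hZ𝔠] at hpre
  -- the two colour classes
  obtain ⟨u, hu⟩ : ∃ u : Set (PrimeSpectrum R),
      u = ⋃ p ∈ {p : PrimeSpectrum R | p.asIdeal ∈ minimalPrimes R ∧ p ∈ S},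
        zeroLocus ((p.asIdeal : Ideal R) : Set R) := ⟨_, rfl⟩
  obtain ⟨v, hv⟩ : ∃ v : Set (PrimeSpectrum R),
      v = ⋃ p ∈ {p : PrimeSpectrum R | p.asIdeal ∈ minimalPrimes R ∧ p ∉ S},
        zeroLocus ((p.asIdeal : Ideal R) : Set R) := ⟨_, rfl⟩
  have huc : IsClosed u := hu ▸ hT₁f.isClosed_biUnion fun p _ => isClosed_zeroLocus _
  have hvc : IsClosed v := hv ▸ hT₂f.isClosed_biUnion fun p _ => isClosed_zeroLocus _
  have hmemu : ∀ x : PrimeSpectrum R, x ∈ u ↔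
      ∃ p : PrimeSpectrum R, (p.asIdeal ∈ minimalPrimes R ∧ p ∈ S) ∧ p.asIdeal ≤ x.asIdeal := by
    intro x
    simp only [hu, Set.mem_iUnion, Set.mem_setOf_eq, mem_zeroLocus_ideal_iff, exists_prop]
  have hmemv : ∀ x : PrimeSpectrum R, x ∈ v ↔
      ∃ p : PrimeSpectrum R, (p.asIdeal ∈ minimalPrimes R ∧ p ∉ S) ∧ p.asIdeal ≤ x.asIdeal := by
    intro x
    simp only [hv, Set.mem_iUnion, Set.mem_setOf_eq, mem_zeroLocus_ideal_iff, exists_prop]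
  have hcov : Zᶜ ⊆ u ∪ v := by
    intro x _
    obtain ⟨P, hP, hPx⟩ :=
      Ideal.exists_minimalPrimes_le (show (⊥ : Ideal R) ≤ x.asIdeal from bot_le)
    by_cases hPS : (⟨P, hP.1.1⟩ : PrimeSpectrum R) ∈ S
    · exact Or.inl ((hmemu x).mpr ⟨⟨P, hP.1.1⟩, ⟨hP, hPS⟩, hPx⟩)
    · exact Or.inr ((hmemv x).mpr ⟨⟨P, hP.1.1⟩, ⟨hP, hPS⟩, hPx⟩)
  have hdisj : Zᶜ ∩ (u ∩ v) = ∅ := by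
    rw [Set.eq_empty_iff_forall_notMem]
    rintro x ⟨hx, hxu, hxv⟩
    obtain ⟨p, hp, hpx⟩ := (hmemu x).mp hxu
    obtain ⟨q, hq, hqx⟩ := (hmemv x).mp hxv
    exact hx ((hmemZ x).mpr ⟨p, hp, q, hq, sup_le hpx hqx⟩)
  rcases hpre u v huc hvc hcov hdisj with h | h
  · -- the whole of `Spec R ∖ Z` is coloured `1`: test with `A₂`
    have hA₂Z : A₂ ∈ Zᶜ := fun hZ' => by
      obtain ⟨p, hp, q, hq, hpq⟩ := (hmemZ _).mp hZ'
      exact lt_irrefl _ (lt_of_lt_of_le (lt_of_le_of_lt (ringKrullDim_le_of_surjective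
        (Ideal.Quotient.factor hpq) (Ideal.Quotient.factor_surjective hpq))
          (hlt p hp.2 q hq.2 hp.1 hq.1)) (hdim _ hA₂))
    obtain ⟨p, hp, hpA₂⟩ := (hmemu A₂).mp (h hA₂Z)
    have heq : p = A₂ := PrimeSpectrum.ext (le_antisymm hpA₂ (hA₂.2 ⟨p.2, bot_le⟩ hpA₂))
    exact hA₂S (heq ▸ hp.2)
  · have hA₁Z : A₁ ∈ Zᶜ := fun hZ' => by
      obtain ⟨p, hp, q, hq, hpq⟩ := (hmemZ _).mp hZ'
      exact lt_irrefl _ (lt_of_lt_of_le (lt_of_le_of_lt (ringKrullDim_le_of_surjective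
        (Ideal.Quotient.factor hpq) (Ideal.Quotient.factor_surjective hpq))
          (hlt p hp.2 q hq.2 hp.1 hq.1)) (hdim _ hA₁))
    obtain ⟨p, hp, hpA₁⟩ := (hmemv A₁).mp (h hA₁Z)
    have heq : p = A₁ := PrimeSpectrum.ext (le_antisymm hpA₁ (hA₁.2 ⟨p.2, bot_le⟩ hpA₁))
    exact hp.2 (heq ▸ hA₁S)

/-- **From pairwise linking to connectedness in dimension `k + 1`.** If for every `2`-colouring of
the components of `Spec R` using both colours two components of different colours meet along a
closed subset of dimension `≥ k + 1`, then `Spec R ∖ Z` is connected for every closed `Z` all of whose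
components have dimension `< k + 1` (the traces `V(P) ∖ Z` of the components are connected and their
intersection graph is connected). [cite: Grothendieck1968SGA2, Exp. XIII, proof of Thm. 2.1] -/
theorem conn_of_pairwise (k : ℕ)
    (hpair : ∀ S : Set (PrimeSpectrum R), (∃ C ∈ S, C.asIdeal ∈ minimalPrimes R) →
      (∃ C ∉ S, C.asIdeal ∈ minimalPrimes R) →
        ∃ C₁ ∈ S, ∃ C₂ ∉ S, C₁.asIdeal ∈ minimalPrimes R ∧ C₂.asIdeal ∈ minimalPrimes R ∧
          ((k + 1 : ℕ) : WithBot ℕ∞) ≤ ringKrullDim (R ⧸ (C₁.asIdeal ⊔ C₂.asIdeal))) :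
    ∀ 𝔠 : Ideal R, (∀ 𝔮 : Ideal R, 𝔮.IsPrime → 𝔠 ≤ 𝔮 →
      ringKrullDim (R ⧸ 𝔮) < ((k + 1 : ℕ) : WithBot ℕ∞)) →
        IsPreconnected (zeroLocus (𝔠 : Set R))ᶜ := by
  intro 𝔠 h𝔠
  set C : {p : PrimeSpectrum R // p.asIdeal ∈ minimalPrimes R} → Set (PrimeSpectrum R) :=
    fun P => zeroLocus (P.1.asIdeal : Set R) \ zeroLocus (𝔠 : Set R) with hCdef
  have hU : (⋃ P, C P) = (zeroLocus (𝔠 : Set R))ᶜ := by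
    ext x
    simp only [Set.mem_iUnion, hCdef, Set.mem_sdiff, Set.mem_compl_iff, mem_zeroLocus_ideal_iff]
    constructor
    · rintro ⟨P, -, hx⟩
      exact hx
    · intro hx
      obtain ⟨P, hP, hPx⟩ :=
        Ideal.exists_minimalPrimes_le (show (⊥ : Ideal R) ≤ x.asIdeal from bot_le)
      exact ⟨⟨⟨P, hP.1.1⟩, hP⟩, hPx, hx⟩
  rw [← hU]
  refine isPreconnected_iUnion_of_crossing (fun P => ?_) fun T hT hTc => ?_
  · haveI := P.1.2
    simp only [hCdef]
    exact isPreconnected_zeroLocus_prime_diff P.1.asIdeal 𝔠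
  · obtain ⟨i₀, hi₀⟩ := hT
    obtain ⟨j₀, hj₀⟩ := hTc
    obtain ⟨C₁, hC₁S, C₂, hC₂S, hC₁, hC₂, hdim12⟩ := hpair
      {p | ∃ h : p.asIdeal ∈ minimalPrimes R,
        (⟨p, h⟩ : {p : PrimeSpectrum R // p.asIdeal ∈ minimalPrimes R}) ∈ T}
      ⟨i₀.1, ⟨i₀.2, hi₀⟩, i₀.2⟩ ⟨j₀.1, fun ⟨_, hj⟩ => hj₀ hj, j₀.2⟩
    obtain ⟨𝔭, h𝔭, h12𝔭, h𝔭dim⟩ := exists_prime_le_ringKrullDim_quotient hdim12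
    have h𝔭𝔠 : ¬ 𝔠 ≤ 𝔭 := fun h => lt_irrefl _ (lt_of_lt_of_le (h𝔠 𝔭 h𝔭 h) h𝔭dim)
    refine ⟨⟨C₁, hC₁⟩, ?_, ⟨C₂, hC₂⟩, fun hT => hC₂S ⟨hC₂, hT⟩, ⟨𝔭, h𝔭⟩, ?_⟩
    · obtain ⟨_, hT⟩ := hC₁S
      exact hT
    · simp only [hCdef, Set.mem_inter_iff, Set.mem_sdiff, mem_zeroLocus_ideal_iff]
      exact ⟨⟨le_sup_left.trans h12𝔭, h𝔭𝔠⟩, le_sup_right.trans h12𝔭, h𝔭𝔠⟩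

end Spectrum

/-! ## The descent step `R ↦ R/aR` in a complete local ring -/

section Step

variable {R : Type u} [CommRing R] [IsNoetherianRing R] [IsLocalRing R]
  [IsAdicComplete (maximalIdeal R) R]

/-- **Cutting a component by a hypersurface loses at most one dimension**: in a complete Noetherian
local ring, a minimal prime `𝔮` of `𝔭 + (a)` (`𝔭` prime) has `dim R/𝔮 ≥ dim R/𝔭 − 1` — Krull's
principal ideal theorem gives `ht(𝔮/𝔭) ≤ 1`, and `R/𝔭` is a catenary local domain (complete local
rings are universally catenary, Matsumura 31.6 / 29.4), so `ht(𝔮/𝔭) + dim R/𝔮 = dim R/𝔭`.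
[cite: Matsumura1987, Thm. 31.6 and §5] -/
theorem le_ringKrullDim_quotient_of_mem_minimalPrimes_sup_span {𝔭 : Ideal R} [h𝔭 : 𝔭.IsPrime]
    {a : R} {𝔮 : Ideal R} (h𝔮 : 𝔮 ∈ (𝔭 ⊔ Ideal.span {a}).minimalPrimes) {n : ℕ}
    (hn : ((n + 1 : ℕ) : WithBot ℕ∞) ≤ ringKrullDim (R ⧸ 𝔭)) :
    (n : WithBot ℕ∞) ≤ ringKrullDim (R ⧸ 𝔮) := by
  haveI h𝔮p : 𝔮.IsPrime := h𝔮.1.1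
  have h𝔭𝔮 : 𝔭 ≤ 𝔮 := le_sup_left.trans h𝔮.1.2
  haveI : Nontrivial (R ⧸ 𝔭) := Ideal.Quotient.nontrivial_iff.mpr h𝔭.ne_top
  haveI : IsLocalRing (R ⧸ 𝔭) := .of_surjective' _ Ideal.Quotient.mk_surjective
  haveI : IsAdicComplete (maximalIdeal (R ⧸ 𝔭)) (R ⧸ 𝔭) := isAdicComplete_quotient 𝔭
  have hcat : IsCatenaryRing (R ⧸ 𝔭) :=
    (isUniversallyCatenaryRing_of_isAdicComplete (R ⧸ 𝔭)).isCatenaryRing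
  set 𝔮' : Ideal (R ⧸ 𝔭) := 𝔮.map (Ideal.Quotient.mk 𝔭) with h𝔮'def
  have hht : 𝔮'.height ≤ 1 := Ideal.map_height_le_one_of_mem_minimalPrimes h𝔮
  haveI h𝔮'p : 𝔮'.IsPrime :=
    Ideal.map_isPrime_of_surjective Ideal.Quotient.mk_surjective (by rwa [Ideal.mk_ker])
  have hform := height_add_ringKrullDim_quotient_eq hcat 𝔮'
  have hiso : ringKrullDim ((R ⧸ 𝔭) ⧸ 𝔮') = ringKrullDim (R ⧸ 𝔮) :=
    ringKrullDim_eq_of_ringEquiv (DoubleQuot.quotQuotEquivQuotOfLE h𝔭𝔮)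
  haveI : Nontrivial ((R ⧸ 𝔭) ⧸ 𝔮') := Ideal.Quotient.nontrivial_iff.mpr h𝔮'p.ne_top
  haveI : IsLocalRing ((R ⧸ 𝔭) ⧸ 𝔮') := .of_surjective' _ Ideal.Quotient.mk_surjective
  obtain ⟨c, hc⟩ := exists_nat_cast_eq_ringKrullDim (R := (R ⧸ 𝔭) ⧸ 𝔮')
  obtain ⟨d, hd⟩ := exists_nat_cast_eq_ringKrullDim (R := R ⧸ 𝔭)
  obtain ⟨e, he⟩ := ENat.ne_top_iff_exists.mp (𝔮'.height_ne_top h𝔮'p.ne_top)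
  rw [hc, hd, ← he] at hform
  rw [hd] at hn
  have h1 : e + c = d := by
    have : ((e : ℕ∞) : WithBot ℕ∞) = ((e : ℕ) : WithBot ℕ∞) := rfl
    rw [this] at hform
    exact_mod_cast hform
  have h2 : e ≤ 1 := by
    rw [← he] at hht
    exact_mod_cast hht
  have h3 : n + 1 ≤ d := by exact_mod_cast hn
  rw [← hiso, hc]
  exact_mod_cast (show n ≤ c by omega)

/-- **Grothendieck's descent step** (SGA 2 XIII, proof of 2.1, the case `m = 1`): let `R` be a complete
Noetherian local ring all of whose irreducible components have dimension `≥ n + 2` and such that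
`Spec R ∖ Z` is connected for every closed `Z` with components of dimension `< n + 1`, and let
`a ∈ R`. Then the minimal primes of `(a)` have dimension `≥ n + 1`, and `V(a) ∖ Z` is connected for
every closed `Z` with components of dimension `< n`: `V(a) ∖ Z` is the union of the connected
(hypersurface theorem in the complete local domains `R/P`) sets `V(P + (a)) ∖ Z` over the components
`V(P)`, any two groups of which meet outside `Z`. [cite: Grothendieck1968SGA2, Exp. XIII Thm. 2.1] -/
theorem grothendieck_step (a : R) (n : ℕ)
    (hsd : ∀ P ∈ minimalPrimes R, ((n + 2 : ℕ) : WithBot ℕ∞) ≤ ringKrullDim (R ⧸ P))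
    (hconn : ∀ 𝔠 : Ideal R,
      (∀ 𝔮 : Ideal R, 𝔮.IsPrime → 𝔠 ≤ 𝔮 → ringKrullDim (R ⧸ 𝔮) < ((n + 1 : ℕ) : WithBot ℕ∞)) →
        IsPreconnected (zeroLocus (𝔠 : Set R))ᶜ) :
    (∀ Q ∈ (Ideal.span {a}).minimalPrimes, ((n + 1 : ℕ) : WithBot ℕ∞) ≤ ringKrullDim (R ⧸ Q)) ∧
    ∀ 𝔠 : Ideal R,
      (∀ 𝔮 : Ideal R, 𝔮.IsPrime → 𝔠 ≤ 𝔮 → ringKrullDim (R ⧸ 𝔮) < (n : WithBot ℕ∞)) →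
        IsPreconnected (zeroLocus ((Ideal.span {a} : Ideal R) : Set R) \ zeroLocus (𝔠 : Set R)) := by
  classical
  -- (i) the components of `V(a)` have dimension `≥ n + 1`
  have hsd' : ∀ Q ∈ (Ideal.span {a}).minimalPrimes,
      ((n + 1 : ℕ) : WithBot ℕ∞) ≤ ringKrullDim (R ⧸ Q) := by
    intro Q hQ
    haveI := hQ.1.1
    obtain ⟨P, hP, hPQ⟩ :=
      Ideal.exists_minimalPrimes_le (show (⊥ : Ideal R) ≤ Q from bot_le)
    haveI := hP.1.1
    have hQ' : Q ∈ (P ⊔ Ideal.span {a}).minimalPrimes :=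
      ⟨⟨hQ.1.1, sup_le hPQ hQ.1.2⟩, fun 𝔯 h𝔯 h𝔯Q => hQ.2 ⟨h𝔯.1, le_sup_right.trans h𝔯.2⟩ h𝔯Q⟩
    exact le_ringKrullDim_quotient_of_mem_minimalPrimes_sup_span hQ' (hsd P hP)
  refine ⟨hsd', fun 𝔠 h𝔠 => ?_⟩
  -- (ii) the unit case: `V(a) = ∅`
  by_cases hunit : IsUnit a
  · exact Set.Subsingleton.isPreconnected fun x hx _ _ =>
      (x.2.ne_top (Ideal.eq_top_of_isUnit_mem _
        (mem_zeroLocus_ideal_iff.mp hx.1 (Ideal.mem_span_singleton_self a)) hunit)).elim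
  have ham : a ∈ maximalIdeal R := (mem_maximalIdeal a).mpr hunit
  -- pairwise linking of the components of `Spec R` in dimension `n + 1`
  have hpair := pairwise_of_conn (R := R) (n + 1) hconn
    fun Q hQ => le_trans (by exact_mod_cast Nat.le_succ _) (hsd Q hQ)
  -- `V(a) ∖ Z` as the union of the `V(P + (a)) ∖ Z`
  set ι := {p : PrimeSpectrum R // p.asIdeal ∈ minimalPrimes R} with hιdef
  set C : ι → Set (PrimeSpectrum R) := fun P =>
    zeroLocus ((P.1.asIdeal ⊔ Ideal.span {a} : Ideal R) : Set R) \ zeroLocus (𝔠 : Set R) with hCdef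
  have hU : (⋃ P, C P) =
      zeroLocus ((Ideal.span {a} : Ideal R) : Set R) \ zeroLocus (𝔠 : Set R) := by
    ext x
    simp only [Set.mem_iUnion, hCdef, Set.mem_sdiff, mem_zeroLocus_ideal_iff, sup_le_iff]
    constructor
    · rintro ⟨P, ⟨-, hax⟩, hx⟩
      exact ⟨hax, hx⟩
    · rintro ⟨hax, hx⟩
      obtain ⟨P, hP, hPx⟩ :=
        Ideal.exists_minimalPrimes_le (show (⊥ : Ideal R) ≤ x.asIdeal from bot_le)
      exact ⟨⟨⟨P, hP.1.1⟩, hP⟩, ⟨hPx, hax⟩, hx⟩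
  rw [← hU]
  refine isPreconnected_iUnion_of_crossing (fun P => ?_) fun T hT hTc => ?_
  · -- each piece is `V(ā) ∖ V(𝔠̄)` in `Spec (R ⧸ 𝔭)`, connected by the hypersurface theorem
    obtain ⟨⟨𝔭, h𝔭p⟩, h𝔭min⟩ := P
    haveI : Nontrivial (R ⧸ 𝔭) := Ideal.Quotient.nontrivial_iff.mpr h𝔭p.ne_top
    haveI : IsLocalRing (R ⧸ 𝔭) := .of_surjective' _ Ideal.Quotient.mk_surjective
    haveI : IsAdicComplete (maximalIdeal (R ⧸ 𝔭)) (R ⧸ 𝔭) := isAdicComplete_quotient 𝔭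
    obtain ⟨d, hd⟩ := exists_nat_cast_eq_ringKrullDim (R := R ⧸ 𝔭)
    have hd2 : n + 2 ≤ d := by
      have := hsd 𝔭 h𝔭min
      rw [hd] at this
      exact_mod_cast this
    have hsurj : Function.Surjective (Ideal.Quotient.mk 𝔭) := Ideal.Quotient.mk_surjective
    have hK : IsPreconnected (zeroLocus ({Ideal.Quotient.mk 𝔭 a} : Set (R ⧸ 𝔭)) \
        zeroLocus ((𝔠.map (Ideal.Quotient.mk 𝔭) : Ideal (R ⧸ 𝔭)) : Set (R ⧸ 𝔭))) := by
      refine isPreconnected_zeroLocus_diff _ _ fun 𝔮' h𝔮' hle => ?_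
      haveI := h𝔮'
      have h𝔮 : 𝔠 ≤ 𝔮'.comap (Ideal.Quotient.mk 𝔭) := Ideal.map_le_iff_le_comap.mp hle
      haveI : IsLocalRing (R ⧸ 𝔮'.comap (Ideal.Quotient.mk 𝔭)) :=
        isLocalRing_quotient (Ideal.IsPrime.ne_top inferInstance)
      obtain ⟨c, hc⟩ := exists_nat_cast_eq_ringKrullDim (R := R ⧸ 𝔮'.comap (Ideal.Quotient.mk 𝔭))
      have hlt : c < n := by
        have := h𝔠 _ inferInstance h𝔮
        rw [hc] at this
        exact_mod_cast this
      rw [← ringKrullDim_quotient_comap_eq_of_surjective _ hsurj 𝔮', hc, hd]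
      exact_mod_cast (show c + 3 ≤ d by omega)
    have hza : zeroLocus ({Ideal.Quotient.mk 𝔭 a} : Set (R ⧸ 𝔭)) =
        zeroLocus (((Ideal.span {a}).map (Ideal.Quotient.mk 𝔭) : Ideal (R ⧸ 𝔭)) : Set (R ⧸ 𝔭)) := by
      rw [Ideal.map_span, Set.image_singleton, zeroLocus_span]
    have himage : comap (Ideal.Quotient.mk 𝔭) ''
        (zeroLocus ({Ideal.Quotient.mk 𝔭 a} : Set (R ⧸ 𝔭)) \
          zeroLocus ((𝔠.map (Ideal.Quotient.mk 𝔭) : Ideal (R ⧸ 𝔭)) : Set (R ⧸ 𝔭))) =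
        zeroLocus ((𝔭 ⊔ Ideal.span {a} : Ideal R) : Set R) \ zeroLocus (𝔠 : Set R) := by
      rw [Set.image_sdiff (comap_injective_of_surjective _ hsurj), hza,
        image_comap_zeroLocus_eq_zeroLocus_comap _ _ hsurj,
        image_comap_zeroLocus_eq_zeroLocus_comap _ _ hsurj, Ideal.comap_map_of_surjective _ hsurj,
        Ideal.comap_map_of_surjective _ hsurj, ← RingHom.ker_eq_comap_bot, Ideal.mk_ker]
      ext x
      simp only [Set.mem_sdiff, mem_zeroLocus_ideal_iff, sup_le_iff]
      constructor
      · rintro ⟨⟨hax, h𝔭x⟩, hx⟩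
        exact ⟨⟨h𝔭x, hax⟩, fun h𝔠x => hx ⟨h𝔠x, h𝔭x⟩⟩
      · rintro ⟨⟨h𝔭x, hax⟩, hx⟩
        exact ⟨⟨hax, h𝔭x⟩, fun h => hx h.1⟩
    simp only [hCdef]
    rw [← himage]
    exact hK.image _ (continuous_comap _).continuousOn
  · -- two colour classes of pieces meet outside `Z`
    obtain ⟨i₀, hi₀⟩ := hT
    obtain ⟨j₀, hj₀⟩ := hTc
    obtain ⟨C₁, hC₁S, C₂, hC₂S, hC₁, hC₂, hdim12⟩ := hpair
      {p | ∃ h : p.asIdeal ∈ minimalPrimes R, (⟨p, h⟩ : ι) ∈ T}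
      ⟨i₀.1, ⟨i₀.2, hi₀⟩, i₀.2⟩ ⟨j₀.1, fun ⟨_, hj⟩ => hj₀ hj, j₀.2⟩
    obtain ⟨𝔭, h𝔭, h12𝔭, h𝔭dim⟩ := exists_prime_le_ringKrullDim_quotient hdim12
    haveI := h𝔭
    have h𝔭m : 𝔭 ⊔ Ideal.span {a} ≤ maximalIdeal R :=
      sup_le (IsLocalRing.le_maximalIdeal h𝔭.ne_top) ((Ideal.span_singleton_le_iff_mem _).mpr ham)
    obtain ⟨𝔮, h𝔮, -⟩ := Ideal.exists_minimalPrimes_le h𝔭m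
    have h𝔮dim : (n : WithBot ℕ∞) ≤ ringKrullDim (R ⧸ 𝔮) :=
      le_ringKrullDim_quotient_of_mem_minimalPrimes_sup_span h𝔮 h𝔭dim
    have h𝔮𝔠 : ¬ 𝔠 ≤ 𝔮 := fun h => lt_irrefl _ (lt_of_lt_of_le (h𝔠 𝔮 h𝔮.1.1 h) h𝔮dim)
    refine ⟨⟨C₁, hC₁⟩, ?_, ⟨C₂, hC₂⟩, fun hT => hC₂S ⟨hC₂, hT⟩, ⟨𝔮, h𝔮.1.1⟩, ?_⟩
    · obtain ⟨_, hT⟩ := hC₁S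
      exact hT
    · simp only [hCdef, Set.mem_inter_iff, Set.mem_sdiff, mem_zeroLocus_ideal_iff]
      exact ⟨⟨(sup_le_sup_right (le_sup_left.trans h12𝔭) _).trans h𝔮.1.2, h𝔮𝔠⟩,
        (sup_le_sup_right (le_sup_right.trans h12𝔭) _).trans h𝔮.1.2, h𝔮𝔠⟩

/-- The descent step for the quotient ring `R/aR` itself: the invariant passes from `(R, n + 1)` to
`(R ⧸ (a), n)`. [cite: Grothendieck1968SGA2, Exp. XIII Thm. 2.1] -/
theorem inv_quotient_span (a : R) (n : ℕ)
    (hsd : ∀ P ∈ minimalPrimes R, ((n + 2 : ℕ) : WithBot ℕ∞) ≤ ringKrullDim (R ⧸ P))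
    (hconn : ∀ 𝔠 : Ideal R,
      (∀ 𝔮 : Ideal R, 𝔮.IsPrime → 𝔠 ≤ 𝔮 → ringKrullDim (R ⧸ 𝔮) < ((n + 1 : ℕ) : WithBot ℕ∞)) →
        IsPreconnected (zeroLocus (𝔠 : Set R))ᶜ) :
    (∀ Q ∈ minimalPrimes (R ⧸ Ideal.span {a}),
      ((n + 1 : ℕ) : WithBot ℕ∞) ≤ ringKrullDim ((R ⧸ Ideal.span {a}) ⧸ Q)) ∧
    ∀ 𝔠 : Ideal (R ⧸ Ideal.span {a}),
      (∀ 𝔮 : Ideal (R ⧸ Ideal.span {a}), 𝔮.IsPrime → 𝔠 ≤ 𝔮 →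
        ringKrullDim ((R ⧸ Ideal.span {a}) ⧸ 𝔮) < (n : WithBot ℕ∞)) →
        IsPreconnected (zeroLocus (𝔠 : Set (R ⧸ Ideal.span {a})))ᶜ := by
  obtain ⟨h1, h2⟩ := grothendieck_step a n hsd hconn
  have hsurj : Function.Surjective (Ideal.Quotient.mk (Ideal.span {a})) :=
    Ideal.Quotient.mk_surjective
  refine ⟨sdim_of_surjective _ hsurj ?_, conn_of_surjective _ hsurj ?_⟩
  · rw [Ideal.mk_ker]
    exact h1
  · rw [Ideal.mk_ker]
    exact h2

/-- **Grothendieck's induction** (SGA 2 XIII, proof of 2.1): the invariant passes from `(R, n + m)`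
to `(R ⧸ (f₁, …, f_m), n)` for `f₁, …, f_m ∈ 𝔪`. [cite: Grothendieck1968SGA2, Exp. XIII Thm. 2.1] -/
theorem inv_quotient_ofList : ∀ (m n : ℕ) {R : Type u} [CommRing R] [IsNoetherianRing R]
    [IsLocalRing R] [IsAdicComplete (maximalIdeal R) R] (fs : List R),
    (∀ f ∈ fs, f ∈ maximalIdeal R) → fs.length = m →
    (∀ P ∈ minimalPrimes R, ((n + m + 1 : ℕ) : WithBot ℕ∞) ≤ ringKrullDim (R ⧸ P)) →
    (∀ 𝔠 : Ideal R,
      (∀ 𝔮 : Ideal R, 𝔮.IsPrime → 𝔠 ≤ 𝔮 → ringKrullDim (R ⧸ 𝔮) < ((n + m : ℕ) : WithBot ℕ∞)) →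
        IsPreconnected (zeroLocus (𝔠 : Set R))ᶜ) →
    (∀ Q ∈ minimalPrimes (R ⧸ Ideal.ofList fs),
      ((n + 1 : ℕ) : WithBot ℕ∞) ≤ ringKrullDim ((R ⧸ Ideal.ofList fs) ⧸ Q)) ∧
    ∀ 𝔠 : Ideal (R ⧸ Ideal.ofList fs),
      (∀ 𝔮 : Ideal (R ⧸ Ideal.ofList fs), 𝔮.IsPrime → 𝔠 ≤ 𝔮 →
        ringKrullDim ((R ⧸ Ideal.ofList fs) ⧸ 𝔮) < (n : WithBot ℕ∞)) →
        IsPreconnected (zeroLocus (𝔠 : Set (R ⧸ Ideal.ofList fs)))ᶜ := by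
  intro m
  induction m with
  | zero =>
    intro n R _ _ _ _ fs _ hlen hsd hconn
    cases fs with
    | cons f fs' => exact absurd hlen (by simp)
    | nil =>
      simp only [Nat.add_zero] at hsd hconn
      exact inv_of_ringEquiv
        ((RingEquiv.quotientBot R).symm.trans (Ideal.quotEquivOfEq (by simp))) hsd hconn
  | succ m ih =>
    intro n R _ _ _ _ fs hfs hlen hsd hconn
    cases fs with
    | nil => exact absurd hlen (by simp)
    | cons f fs' =>
      have hlen' : fs'.length = m := by simpa using hlen
      have hfm : f ∈ maximalIdeal R := hfs f (by simp)
      have e1 : n + (m + 1) + 1 = n + m + 2 := by omega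
      have e2 : n + (m + 1) = n + m + 1 := by omega
      rw [e1] at hsd
      rw [e2] at hconn
      obtain ⟨h1, h2⟩ := inv_quotient_span f (n + m) hsd hconn
      -- the complete local ring `R ⧸ (f)`
      have hne : Ideal.span {f} ≠ ⊤ := fun h =>
        (mem_maximalIdeal f).mp hfm (Ideal.span_singleton_eq_top.mp h)
      haveI : IsLocalRing (R ⧸ Ideal.span {f}) := isLocalRing_quotient hne
      haveI : IsAdicComplete (maximalIdeal (R ⧸ Ideal.span {f})) (R ⧸ Ideal.span {f}) :=
        isAdicComplete_quotient _
      have hfs' : ∀ g ∈ fs'.map (Ideal.Quotient.mk (Ideal.span {f})),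
          g ∈ maximalIdeal (R ⧸ Ideal.span {f}) := by
        intro g hg
        obtain ⟨x, hx, rfl⟩ := List.mem_map.mp hg
        rw [← map_maximalIdeal_of_surjective (Ideal.Quotient.mk (Ideal.span {f}))
          Ideal.Quotient.mk_surjective]
        exact Ideal.mem_map_of_mem _ (hfs x (List.mem_cons_of_mem f hx))
      obtain ⟨h3, h4⟩ := ih n (fs'.map (Ideal.Quotient.mk (Ideal.span {f}))) hfs'
        (by simp [hlen']) h1 h2
      -- back to `R ⧸ (f, f₂, …)` along `(R/(f))/(f₂, …) ≅ R/(f, f₂, …)`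
      exact inv_of_ringEquiv
        ((Ideal.quotEquivOfEq (Ideal.map_ofList (Ideal.Quotient.mk (Ideal.span {f})) fs').symm).trans
          ((DoubleQuot.quotQuotEquivQuotSup (Ideal.span {f}) (Ideal.ofList fs')).trans
            (Ideal.quotEquivOfEq (Ideal.ofList_cons f fs').symm))) h3 h4

end Step

/-! ## The theorem -/

/-- **Grothendieck's connectedness theorem** (SGA 2 XIII 2.1), discharging the named fact
`GrothendieckConnectedness`. [cite: Grothendieck1968SGA2, Exp. XIII Thm. 2.1] -/
theorem GrothendieckConnectedness_holds : GrothendieckConnectedness := by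
  intro A _ _ _ _ k _ hsd hpair fs hfs hlen
  have hconnA := conn_of_pairwise k hpair
  have e1 : k - fs.length + 1 + fs.length + 1 = k + 2 := by omega
  have e2 : k - fs.length + 1 + fs.length = k + 1 := by omega
  have e3 : k - fs.length + 2 = k - fs.length + 1 + 1 := by omega
  obtain ⟨hA, hB⟩ := inv_quotient_ofList fs.length (k - fs.length + 1) fs hfs rfl
    (by rw [e1]; exact hsd) (by rw [e2]; exact hconnA)
  refine ⟨fun Q hQ => ?_, ?_⟩
  · rw [e3]
    exact hA Q hQ
  · exact pairwise_of_conn (k - fs.length + 1) hB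
      fun Q hQ => le_trans (by exact_mod_cast Nat.le_succ _) (hA Q hQ)

end Literature.RingTheory.LocalCohomology

end
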